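import Summits.ResolutionOfSingularities.ResolutionOfSingularities.Theorems.FrobeniusClosingPatchingRelPerfectDepthPhaseCLocalGameBridge
import Summits.ResolutionOfSingularities.ResolutionOfSingularities.Theorems.FrobeniusClosingPatchingRelPerfectDepthPhaseCX3Defs
import HarnessLib

/-!
# Crux `PatchingRelPerfect` (stmt-ResolutionOfSingularities-16161), chain W5.2 — F7(β) (β-AX) C-I: (G-A) BY NAME

[OURS · L1 W5.2 · F7(β) (β-AX) X3 C-I (res-L1-w52-plan-1 g12 RULING G12-41 (4): the by-name wrapper of (G-A) over res-L1-w52-lead-1΄s defs module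
`…DepthPhaseCX3Defs` p569657)] Fact-free; def-free; NOT statements of the manuscript under review (Hironaka 2017); AI-written, weaker than expert
review.

* `X3LemmaM.endOrderReductionSuffices_holds : EndOrderReductionSuffices` — (G-A) by name (δ-instance of res-D-pv-054΄s unfolded
  `X3LocalGame.hLMG_of_orderReduction`, p570006 / p568760): marked order reduction for every `m ≥ 1` implies the locally monomial game.
* `X3LemmaM.phaseCOne_cylReach_of_endOrderReduction` — `PhaseCOne CylReach` from `∀ m ≥ 1, EndOrderReduction m` and the pole cures to `GoodEnd`.

## References
* J. Kollár, *Lectures on Resolution of Singularities* (2007), (3.111) Step 3. [Kollar2007]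
-/

-- `Summit.<Summit>.<Sub>.Theorems` with `Sub = Summit` (single-conjunct summit, D-0017)
set_option linter.dupNamespace false

noncomputable section

open CategoryTheory CategoryTheory.Limits AlgebraicGeometry TopologicalSpace IsLocalRing
open Literature.AlgebraicGeometry.Resolution Scheme.IdealSheafData

namespace Summit.ResolutionOfSingularities.ResolutionOfSingularities.Theorems

universe u

namespace X3LemmaM

open DepthMultiHost ChainW52F7BetaRP

/-- [OURS · L1 W5.2 · C-I (G-A)] **ORDER REDUCTION SUFFICES** (`EndOrderReductionSuffices`, by name): marked order reduction for locally-END ideals,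
for every `m ≥ 1`, implies `LocallyMonomialGame`. [cite: Kollar2007, (3.111) Step 3] -/
theorem endOrderReductionSuffices_holds : EndOrderReductionSuffices.{u} :=
  fun h => X3LocalGame.hLMG_of_orderReduction fun m hm => h m hm

/-- [OURS · L1 W5.2 · C-I] **`PhaseCOne CylReach` from (G-T) `∀ m ≥ 1, EndOrderReduction m` and the pole cures to `GoodEnd`** (res-L1-w52-lead-1΄s
(A) interface `phaseCOne_cylReach_of_stages` with `Good := GoodEnd`, stage 2 by (G-A)). [cite: Kollar2007, (3.111) Steps 1–3] -/
theorem phaseCOne_cylReach_of_endOrderReduction (hred : ∀ m : ℕ, 1 ≤ m → EndOrderReduction.{u} m)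
    (hCure : ∀ {X : Scheme.{u}} [IsNoetherian X], Scheme.IsRegular X → Scheme.IsExcellent X →
      ∀ (S : MultiHostState X) (cyl : CylState S) [IsIntegral cyl.Z] [IsNoetherian cyl.Z], Scheme.IsRegular cyl.Z → S.n ≠ 0 →
      ∀ (𝓒 : List X.IdealSheafData) (𝓗 : Fin S.n → List (X.IdealSheafData × ℕ)), S.IsFormatSncOn cyl.V 𝓒 𝓗 → CylReach S cyl →
      ∃ c : CentreSeq X, c.AllRegular ∧ c.CentresOver (S.residual.K.support : Set X) ∧ Scheme.IsRegular c.top ∧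
        ∃ _ : IsNoetherian c.top, GoodEnd (S.residual.K.comap c.comp)) :
    PhaseCOne CylReach.{u} :=
  phaseCOne_cylReach_of_stages GoodEnd (endOrderReductionSuffices_holds hred) hCure

end X3LemmaM

end Summit.ResolutionOfSingularities.ResolutionOfSingularities.Theorems

end
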